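import Summits.Ventures.Crystal3D.StickySpheres.EightCensusSearch3
import Summits.Ventures.Crystal3D.StickySpheres.EightCensusCover
import HarnessLib

/-!
# Coverage of the degree-three eight-ball census search and the main combinatorial statement (ENUM-A(b))

Venture `Crystal3D` (cell `pub-crystal3d`, seat p2). Companion of `EightCensusSearch.lean`: the ordinary induction showing
that the pruned depth-first search `search 6 0 base cnt0` visits every admissible set of missing slots (`leafOK_of_search`,
with the per-vertex missing counts `mcnt` maintained by `bump`), and the main statement `exists_patternB` consumed by the
geometric eight-ball census file.

HONEST FRAMING: pure combinatorics; nothing geometric is claimed here.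
-/

namespace Summit.Ventures.Crystal3D

namespace EightCensus3

open Finset EightSearch EightCensus
open scoped BigOperators

/-! ### Coverage -/

/-- Entry `v` of a count list. [folklore] -/
def cntAt (cnt : List ℕ) (v : V) : ℕ := cnt.getD v.val 0

/-- Missing count of vertex `v`: the initial entry plus the slots of `S` incident to `v`. [folklore] -/
def mcnt (cnt : List ℕ) (S : Finset ℕ) (v : V) : ℕ := cntAt cnt v + (S.filter fun i => sinc v i = true).card


/-- `bump` keeps the length `8` of a count list (the `EightCensus3` slots; cf. `EightCensus.length_bump`). [folklore] -/
theorem length_bump3 {cnt : List ℕ} (hlen : cnt.length = 8) (i : ℕ) (hi : i < 21) : (bump cnt i).length = 8 := by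
  obtain ⟨c0, c1, c2, c3, c4, c5, c6, c7, rfl⟩ := EightCensus.exists_eight_of_length hlen
  interval_cases i <;> rfl

/-- `bump` adds one exactly at the two endpoints of the slot. [folklore] -/
theorem cntAt_bump (c0 c1 c2 c3 c4 c5 c6 c7 : ℕ) (i : ℕ) (hi : i < 21) (v : V) :
    cntAt (bump [c0, c1, c2, c3, c4, c5, c6, c7] i) v =
      cntAt [c0, c1, c2, c3, c4, c5, c6, c7] v + (if sinc v i = true then 1 else 0) := by
  interval_cases i <;> fin_cases v <;> rfl

/-- `okAt` false means an endpoint of the slot misses more than three slots. [folklore] -/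
theorem exists_gt_of_okAt_false {cnt : List ℕ} {i : ℕ} (h : okAt cnt i = false) :
    ∃ v : V, sinc v i = true ∧ 4 < cntAt cnt v := by
  simp only [okAt, Bool.and_eq_false_iff, decide_eq_false_iff_not, not_le] at h
  rcases h with h | h
  · exact ⟨(slotEnds i).1, by simp [sinc], h⟩
  · exact ⟨(slotEnds i).2, by simp [sinc], h⟩

/-- `sortedOK` is the Boolean form of `CSorted`. [folklore] -/
theorem sortedOK_iff (cnt : List ℕ) : sortedOK cnt = true ↔
    (cntAt cnt 1 ≤ cntAt cnt 0 ∧ cntAt cnt 2 ≤ cntAt cnt 1 ∧ cntAt cnt 3 ≤ cntAt cnt 2 ∧ cntAt cnt 5 ≤ cntAt cnt 4 ∧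
      cntAt cnt 6 ≤ cntAt cnt 5) := by
  simp only [sortedOK, cntAt, Bool.and_eq_true, decide_eq_true_eq]
  constructor
  · rintro ⟨⟨⟨⟨h1, h2⟩, h3⟩, h4⟩, h5⟩; exact ⟨h1, h2, h3, h4, h5⟩
  · rintro ⟨h1, h2, h3, h4, h5⟩; exact ⟨⟨⟨⟨h1, h2⟩, h3⟩, h4⟩, h5⟩

/-- The recurrence of the missing counts along the search. [folklore] -/
theorem mcnt_erase {cnt : List ℕ} (hlen : cnt.length = 8) {S : Finset ℕ} {i : ℕ} (hiS : i ∈ S) (hi : i < 21) (v : V) :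
    mcnt cnt S v = mcnt (bump cnt i) (S.erase i) v := by
  obtain ⟨c0, c1, c2, c3, c4, c5, c6, c7, rfl⟩ := EightCensus.exists_eight_of_length hlen
  unfold mcnt
  rw [cntAt_bump c0 c1 c2 c3 c4 c5 c6 c7 i hi v]
  have hsplit : (S.filter fun j => sinc v j = true).card =
      ((S.erase i).filter fun j => sinc v j = true).card + (if sinc v i = true then 1 else 0) := by
    by_cases hs : sinc v i = true
    · rw [if_pos hs]
      have : (S.filter fun j => sinc v j = true) = insert i ((S.erase i).filter fun j => sinc v j = true) := by
        ext j
        simp only [Finset.mem_filter, Finset.mem_insert, Finset.mem_erase]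
        constructor
        · rintro ⟨hj, hsj⟩
          by_cases hji : j = i
          · exact Or.inl hji
          · exact Or.inr ⟨⟨hji, hj⟩, hsj⟩
        · rintro (rfl | ⟨⟨_, hj⟩, hsj⟩)
          · exact ⟨hiS, hs⟩
          · exact ⟨hj, hsj⟩
      rw [this, Finset.card_insert_of_notMem (by simp)]
    · rw [if_neg hs, add_zero]
      congr 1
      ext j
      simp only [Finset.mem_filter, Finset.mem_erase]
      constructor
      · rintro ⟨hj, hsj⟩
        refine ⟨⟨?_, hj⟩, hsj⟩
        rintro rfl
        exact hs hsj
      · rintro ⟨⟨_, hj⟩, hsj⟩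
        exact ⟨hj, hsj⟩
  rw [hsplit]
  omega

/-- Coverage: a successful `search k s c cnt` certifies `LeafOK` for every admissible completion. [folklore] -/
theorem leafOK_of_search : ∀ (k s c : ℕ) (cnt : List ℕ), cnt.length = 8 → search k s c cnt = true →
    ∀ S : Finset ℕ, (∀ i ∈ S, s ≤ i ∧ i < 21) → S.card = k →
      (∃ v, 4 < mcnt cnt S v) ∨
      ¬ (mcnt cnt S 1 ≤ mcnt cnt S 0 ∧ mcnt cnt S 2 ≤ mcnt cnt S 1 ∧ mcnt cnt S 3 ≤ mcnt cnt S 2 ∧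
          mcnt cnt S 5 ≤ mcnt cnt S 4 ∧ mcnt cnt S 6 ≤ mcnt cnt S 5) ∨
      testP (c + ∑ i ∈ S, 2 ^ i) = true := by
  intro k
  induction k with
  | zero =>
    intro s c cnt _ h S _ hcard
    have hS0 : S = ∅ := Finset.card_eq_zero.1 hcard
    subst hS0
    have hm : ∀ v, mcnt cnt ∅ v = cntAt cnt v := fun v => by simp [mcnt]
    simp only [hm]
    simp only [search, Bool.or_eq_true, Bool.not_eq_eq_eq_not, Bool.not_true] at h
    simp only [Finset.sum_empty, add_zero]
    rcases h with h | h
    · right; left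
      intro hs
      have := (sortedOK_iff cnt).2 hs
      rw [this] at h
      exact Bool.noConfusion h
    · right; right; exact h
  | succ k ih =>
    intro s c cnt hlen h S hS hcard
    simp only [search, List.all_eq_true, Bool.or_eq_true, Bool.not_eq_eq_eq_not, Bool.not_true] at h
    have hne : S.Nonempty := by rw [← Finset.card_pos, hcard]; omega
    set i := S.min' hne with hidef
    have hiS : i ∈ S := Finset.min'_mem S hne
    have hmin : ∀ j ∈ S, i ≤ j := fun j hj => Finset.min'_le S j hj
    have hi21 := hS i hiS
    have hstep := h i (List.mem_range'_1.2 ⟨hi21.1, by omega⟩)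
    obtain ⟨c0, c1, c2, c3, c4, c5, c6, c7, rfl⟩ := EightCensus.exists_eight_of_length hlen
    have hlen' : (bump [c0, c1, c2, c3, c4, c5, c6, c7] i).length = 8 := length_bump3 rfl i hi21.2
    have hrec : ∀ v, mcnt [c0, c1, c2, c3, c4, c5, c6, c7] S v =
        mcnt (bump [c0, c1, c2, c3, c4, c5, c6, c7] i) (S.erase i) v := fun v => mcnt_erase hlen hiS hi21.2 v
    rcases hstep with hok | hsearch
    · -- pruned: some endpoint misses more than three slots already
      obtain ⟨v, _, hv⟩ := exists_gt_of_okAt_false hok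
      left
      refine ⟨v, ?_⟩
      rw [hrec v]
      unfold mcnt
      omega
    · have h' := ih (i + 1) (c + 2 ^ i) _ hlen' hsearch (S.erase i) (fun j hj => ?_) ?_
      · have e := Finset.add_sum_erase S (fun x => (2 : ℕ) ^ x) hiS
        rw [add_assoc, e] at h'
        have hm : mcnt (bump [c0, c1, c2, c3, c4, c5, c6, c7] i) (S.erase i) = mcnt [c0, c1, c2, c3, c4, c5, c6, c7] S := by
          funext v; exact (hrec v).symm
        rw [hm] at h'
        exact h'
      · obtain ⟨hji, hjS⟩ := Finset.mem_erase.1 hj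
        refine ⟨?_, (hS j hjS).2⟩
        have h1 := hmin j hjS
        have h2 : i ≠ j := fun h => hji h.symm
        omega
      · rw [Finset.card_erase_of_mem hiS, hcard]
        omega

/-- What a table hit means. [folklore] -/
theorem exists_of_testP {M : Finset ℕ} (h : testP (∑ i ∈ M, 2 ^ i) = true) :
    ∃ p ∈ cpat3List, (p.good = true ∧ maskOf p.edges = ALL28 ^^^ (∑ i ∈ M, 2 ^ i)) ∨
      (p.good = false ∧ ∀ e ∈ p.edges, pidx e.1 e.2 ∉ M) := by
  rw [testP, cpats_eq, List.any_eq_true] at h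
  obtain ⟨bm, hbm, hc⟩ := h
  obtain ⟨p, hp, rfl⟩ := List.mem_map.1 hbm
  refine ⟨p, hp, ?_⟩
  by_cases hg : p.good = true
  · simp only [hg, if_true] at hc
    exact Or.inl ⟨hg, Nat.eq_of_beq_eq_true hc⟩
  · simp only [hg, if_false, Bool.false_eq_true] at hc
    exact Or.inr ⟨by simpa using hg, not_mem_of_land_eq_zero (Nat.eq_of_beq_eq_true hc)⟩

/-- The base slots `21,…,24` contribute the counts `cnt0`: slot `21 + a` is the pair `{a, 7}`. [folklore] -/
theorem cntAt_cnt0 (v : V) :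
    cntAt cnt0 v = (({21, 22, 23, 24} : Finset ℕ).filter fun i => ∃ u : V, u ≠ v ∧ pidx u v = i).card := by
  fin_cases v <;> decide

/-- **Main combinatorial statement (ENUM-A(c)).** `M` = the ten missing slots of an 18-edge graph on `Fin 8` with `21,22,23 ∈ M`,
all other missing slots `< 21`, at most three missing slots at every vertex, missing counts non-increasing along `0,1,2`
and along `3,4,5,6`. Then a BAD pattern of `cpatList` avoids `M`, or a GOOD one has edge mask `ALL28 ^^^ ∑_{i∈M} 2^i`.
[folklore] -/
theorem exists_patternB (M : Finset ℕ) (hM : ∀ i ∈ M, i < 21 ∨ i = 21 ∨ i = 22 ∨ i = 23 ∨ i = 24) (h21 : 21 ∈ M)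
    (h22 : 22 ∈ M) (h23 : 23 ∈ M) (h24 : 24 ∈ M) (hcard : M.card = 10)
    (hdeg : ∀ v : V, (M.filter fun i => ∃ u : V, u ≠ v ∧ pidx u v = i).card ≤ 4)
    (hsort : (fun v : V => (M.filter fun i => ∃ u : V, u ≠ v ∧ pidx u v = i).card) 1 ≤
        (fun v : V => (M.filter fun i => ∃ u : V, u ≠ v ∧ pidx u v = i).card) 0 ∧
      (fun v : V => (M.filter fun i => ∃ u : V, u ≠ v ∧ pidx u v = i).card) 2 ≤
        (fun v : V => (M.filter fun i => ∃ u : V, u ≠ v ∧ pidx u v = i).card) 1 ∧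
      (fun v : V => (M.filter fun i => ∃ u : V, u ≠ v ∧ pidx u v = i).card) 3 ≤
        (fun v : V => (M.filter fun i => ∃ u : V, u ≠ v ∧ pidx u v = i).card) 2 ∧
      (fun v : V => (M.filter fun i => ∃ u : V, u ≠ v ∧ pidx u v = i).card) 5 ≤
        (fun v : V => (M.filter fun i => ∃ u : V, u ≠ v ∧ pidx u v = i).card) 4 ∧
      (fun v : V => (M.filter fun i => ∃ u : V, u ≠ v ∧ pidx u v = i).card) 6 ≤
        (fun v : V => (M.filter fun i => ∃ u : V, u ≠ v ∧ pidx u v = i).card) 5) :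
    ∃ p ∈ cpat3List, (p.good = true ∧ maskOf p.edges = ALL28 ^^^ (∑ i ∈ M, 2 ^ i)) ∨
      (p.good = false ∧ ∀ e ∈ p.edges, pidx e.1 e.2 ∉ M) := by
  classical
  set S : Finset ℕ := M.filter fun i => i < 21 with hSdef
  have hB : M.filter (fun i => ¬ i < 21) = {21, 22, 23, 24} := by
    ext i
    simp only [Finset.mem_filter, Finset.mem_insert, Finset.mem_singleton]
    constructor
    · rintro ⟨hi, hlt⟩
      rcases hM i hi with h | h | h | h | h
      · exact absurd h hlt
      · exact Or.inl h
      · exact Or.inr (Or.inl h)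
      · exact Or.inr (Or.inr (Or.inl h))
      · exact Or.inr (Or.inr (Or.inr h))
    · rintro (rfl | rfl | rfl | rfl)
      · exact ⟨h21, by omega⟩
      · exact ⟨h22, by omega⟩
      · exact ⟨h23, by omega⟩
      · exact ⟨h24, by omega⟩
  have hMS : M = S ∪ {21, 22, 23, 24} := by rw [hSdef, ← hB, Finset.filter_union_filter_not_eq]
  have hdisj : Disjoint S {21, 22, 23, 24} := by
    rw [hSdef, ← hB]; exact Finset.disjoint_filter_filter_not M M fun i => i < 21
  have hScard : S.card = 6 := by
    have h := Finset.card_union_of_disjoint hdisj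
    rw [← hMS, hcard] at h
    have h3 : ({21, 22, 23, 24} : Finset ℕ).card = 4 := by decide
    omega
  have hS21 : ∀ i ∈ S, 0 ≤ i ∧ i < 21 := fun i hi => ⟨Nat.zero_le _, (Finset.mem_filter.1 hi).2⟩
  have hsum : ∑ i ∈ M, 2 ^ i = base + ∑ i ∈ S, 2 ^ i := by
    rw [hMS, Finset.sum_union hdisj, add_comm]; congr 1
  -- the missing counts of `M` are `mcnt cnt0 S`
  have hcount : ∀ v : V, (M.filter fun i => ∃ u : V, u ≠ v ∧ pidx u v = i).card = mcnt cnt0 S v := by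
    intro v
    rw [mcnt, cntAt_cnt0, hMS, Finset.filter_union, Finset.card_union_of_disjoint
      (Finset.disjoint_filter_filter hdisj), add_comm]
    congr 1
    rw [hSdef, Finset.filter_filter, Finset.filter_filter]
    congr 1
    ext i
    simp only [Finset.mem_filter]
    constructor
    · rintro ⟨hiM, hi, hex⟩; exact ⟨hiM, hi, (sinc_iff v i hi).2 hex⟩
    · rintro ⟨hiM, hi, hs⟩; exact ⟨hiM, hi, (sinc_iff v i hi).1 hs⟩
  have hleaf := leafOK_of_search 6 0 base cnt0 rfl search_six S hS21 hScard
  rw [← hsum] at hleaf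
  rcases hleaf with ⟨v, hv⟩ | hns | hP
  · exfalso
    have := hdeg v
    rw [hcount v] at this
    omega
  · exfalso
    apply hns
    simp only [hcount] at hsort
    exact hsort
  · exact exists_of_testP hP

end EightCensus3

end Summit.Ventures.Crystal3D
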